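import Summits.BirchSwinnertonDyer.BirchSwinnertonDyer.Theorems.ByReductionTypeAtTwoAdditiveReducibleKatoMember
import Summits.BirchSwinnertonDyer.BirchSwinnertonDyer.Theses.ByReductionTypeAtTwo
import Literature.NumberTheory.EllipticCurves.Kato2004.MemberHullInputsTwoSharp
import HarnessLib

/-!
# Crux `AdditiveRankZeroAtTwo` (K4 item 19098), child C2″ stmt-BirchSwinnertonDyer-22616
# `AdditivePotGoodReducibleRestAtTwo`: the `E[2]`-REDUCIBLE additive potentially-good block's UPPER half at `2`
# IN FULL from Kato's member package with the SHARP count (`Kato2004.exists_memberHullInputs_two_sharp`), by name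

Seat `bsd-2adic-k4-w2` GEN 4 (prover, cell `bsd-2adic`, rung K4). `--supports stmt-BirchSwinnertonDyer-22616`; closes
nothing (every theorem is CONDITIONAL on named facts — the route decl is reached verbatim in §5, modulo PRINT). HONEST
FRAMING: BSD is not proved by any of this. What changes: the research content «(BIG) ∧ (PAR)» that k4-w2 GEN 3 isolated
in C2″ (`…AdditiveReducibleRestParitySplit.lean`, p669791/p671491) disappears from the UPPER half — the member bound at
`2` is BSD-sharp once the count of the member package is read with the exponent `2t` (reading step R12♯ of
`Kato2004/MemberHullInputsTwoSharp.lean`: in the Poitou–Tate count the factor `#H¹_F(ℚ,T)` and Cassels' cokernel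
`#(S₂(E/ℚ)/H¹_F(ℚ,T))` multiply to `#S₂(E/ℚ) = 2^t`), and a BSD-sharp upper half transports along every `ℚ`-isogeny
(Cassels). So C2″ is now PRINT-conditional: {the sharp reading (D-audit wanted, flag
`Kato-12.4-12.6-13.10-14.14-member-hull-reading-reducible-at-two-SHARP-COUNT`), Lim 2017 Thm. 3.5 at `2`,
Ferrero–Washington, Cassels 1965, Cassels–Tate is NOT needed, GZK, modularity}.

* §0 `exists_memberHullInputs_two_of_sharp` — the sharp fact implies the audited one (bookkeeping).
* §1 `katoMemberShaBound_two_sharp` — at Kato's member `W' ∼ W`: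
  `ord₂ #Ш(W')[2^∞] + v₂ Tam(W') ≤ ord₂(L(W',1)/Ω(W')) + 2·ord₂ #W'(ℚ)_tors` (proof = §1 of
  `…AdditiveReducibleKatoMember.lean` word for word, the sharp count in place of `K.count`).
* §2 `missingUpperBoundAt_of_sharpKatoCurrency` — Miller currency: a `2t`-count IS `MissingUpperBoundAt W' p`
  (`#Ш_an = L·#tors²/(Ω·Tam)` in rank `0`; the proof of `O6.exists_shaAn_le_add_torsion_of_katoCurrency` with `2t`).
* §3 `missingUpperBoundAt_two_of_katoMemberSharp_two` — `MissingUpperBoundAt W 2` for EVERY globally minimal non-CM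
  `W` additive and potentially good at `2` with `W[2]` reducible and `r_an(W) = 0` (Cassels transport from the member,
  `TwistComparison.missingUpperBoundAt_of_isIsogenous`). No torsion side condition, no parity hypothesis.
* §4 `additivePotGoodReducibleUpperAtTwo_of_sharpMember` — the block form keyed by `Addv W 2`.
* §5 `additivePotGoodReducibleRestAtTwo_of_sharpMember` — the route decl C2″
  `Summit.BirchSwinnertonDyer.BirchSwinnertonDyer.Theses.ByReductionTypeAtTwo.AdditivePotGoodReducibleRestAtTwo`
  VERBATIM, conditional on the named facts (its «rest» hypothesis is not even used).

References: [Kato2004Asterisque] Thm. 12.4–12.6 (pp. 221–222), Lemma 13.10 (1) (p. 230), 13.14 (p. 234), Thm. 14.5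
(p. 236), §14.8 (p. 238), §14.14–Lemma 14.15 (pp. 243–244), Prop. 14.16 (2) and its proof (pp. 244–245);
[MazurRubin2004] Thm. 2.3.4; [GreenbergLNM1716] Prop. 4.13; [Lim2017FineSelmer] Thm. 3.5; [FerreroWashington1979];
[Cassels1965ArithmeticVIII]; [MilneADT2006] I.7.3; [Miller2011LMS] Def. 1.1. Memo:
`run/shared/lean/pub/bsd-2adic/k4w2/gen4/READING-hMH2sharp-count-2t.md`.
-/

set_option autoImplicit false
set_option linter.dupNamespace false

noncomputable section

open scoped Classical

namespace Summit.BirchSwinnertonDyer.BirchSwinnertonDyer.Theorems.AddKatoTwo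

open WeierstrassCurve Literature.NumberTheory.EllipticCurves
  Literature.NumberTheory.EllipticCurves.ModularForms
  Literature.NumberTheory.EllipticCurves.Kato2004
  Literature.NumberTheory.EllipticCurves.IwasawaAlgebra
  Literature.NumberTheory.EllipticCurves.Rank1Residual
  Literature.NumberTheory.EllipticCurves.Rank1Residual.Typed
  Literature.NumberTheory.IwasawaTheory
  Summit.BirchSwinnertonDyer.Rank1Residual Summit.BirchSwinnertonDyer.Rank1Residual.Additive
  Summit.BirchSwinnertonDyer.Rank1Residual.X5.AddTwoL2

/-! ## §0 The sharp fact implies the audited one -/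

/-- The sharp member fact `Kato2004.exists_memberHullInputs_two_sharp` implies the audited one
`Kato2004.exists_memberHullInputs_two`: the package `K` it provides inhabits `MemberHullInputs W_K 2 κ γ I 𝐲` (its own
field `K.count`, exponent `3t`, is not even compared). Bookkeeping, so that every consumer of the audited fact is a
consumer of the sharp one. [cite: Kato2004Asterisque, Prop. 14.16 (2) (p. 244)] -/
theorem exists_memberHullInputs_two_of_sharp (h : Kato2004.exists_memberHullInputs_two_sharp) :
    Kato2004.exists_memberHullInputs_two := by
  intro W _ _ hcm hng hnm hj hred hL hfin
  obtain ⟨W', hE', hM', hiso, hrest⟩ := h W hcm hng hnm hj hred hL hfin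
  refine ⟨W', hE', hM', hiso, ?_⟩
  intro _ _ _ hA N _ f hf ι
  obtain ⟨κ', Λ', c, d, a, A, z, x, hκ', hA0, hc, hd, hbody, hpack⟩ := hrest hA f hf ι
  refine ⟨κ', Λ', c, d, a, A, z, x, hκ', hA0, hc, hd, hbody, ?_⟩
  intro κ γ hκ hγ I y hy
  obtain ⟨K, -⟩ := hpack κ γ hκ hγ I y hy
  exact ⟨K⟩

/-! ## §1 Kato's member bound at `p = 2`, SHARP (exponent `2t`) -/

/-- **Kato's member bound at `p = 2` for REDUCIBLE `E[2]`, SHARP** — granted modularity (`hmod`), the sharp member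
fact `Kato2004.exists_memberHullInputs_two_sharp` (`hin`: Kato Thm. 12.4, 12.5 (1)–(3), 12.6 + 13.10 (1) + 13.14,
§14.14, 14.5 (1)(2) and the rank-`0` count with the exact Cassels cokernel at `T = V_{ℤ₂}(f)(1)`), Lim 2017 Thm. 3.5
at `2` (`hLim2`) and Ferrero–Washington (`hFW`) BY NAME: for `W/ℚ` globally minimal, non-CM, additive and potentially
good at `2`, `W[2]` reducible, `L(W,1) ≠ 0`, `Ш(W)` finite, Kato's member `W' ∼ W` is globally minimal with `Ш(W')`
finite and `ord₂ #Ш(W')[2^∞] + v₂ Tam(W') ≤ ord₂(L(W',1)/Ω(W')) + 2·ord₂ #W'(ℚ)_tors`. Statement (A) at `(W',2)` is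
DISCHARGED (`conjA_two_of_not_irreducible`); the rest is `katoMemberShaBound_two_of_memberHullInputs_two` word for
word with the sharp count. Conditional on `hmod`, `hin`, `hLim2`, `hFW`.
[cite: Kato2004Asterisque, Thm. 12.6 (p. 222), Lemma 13.10 (1) (p. 230), 13.14 (p. 234), §14.14 and Lemma 14.15 (pp. 243–244), Prop. 14.16 (2) and its proof (pp. 244–245), §14.8 (p. 238)]
[cite: MazurRubin2004, Thm. 2.3.4] [cite: Lim2017FineSelmer, §3 Thm. 3.5] [cite: FerreroWashington1979, Theorem] -/
theorem katoMemberShaBound_two_sharp (hmod : exists_isNewformOf)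
    (hin : Kato2004.exists_memberHullInputs_two_sharp)
    (hLim2 : Lim2017.thm35_at_two_fineSelmerDual_moduleFinite_of_classicalMuVanishes_of_le_divisionField_four)
    (hFW : ferreroWashington1979_classicalMuVanishes)
    (W : WeierstrassCurve ℚ) [W.IsElliptic] [W.IsGloballyMinimal] (hcm : ¬ W.HasCM)
    (hng : ¬ W.HasGoodReductionAtPrime 2) (hnm : ¬ W.HasMultiplicativeReductionAtPrime 2)
    (hj : 0 ≤ padicValRat 2 W.j) (hred : ¬ W.HasIrreducibleModPGaloisRep 2)
    (hL : W.entireLFunction 1 ≠ 0) (hfin : Finite W.sha) :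
    ∃ (W' : WeierstrassCurve ℚ) (_ : W'.IsElliptic) (_ : W'.IsGloballyMinimal),
      IsIsogenous W W' ∧ Finite W'.sha ∧
      ∃ q : ℚ, W'.entireLFunction 1 / (W'.realPeriodRat : ℂ) = (q : ℂ) ∧
        (padicValNat 2 (Nat.card (AddCommGroup.primaryComponent W'.sha 2)) : ℤ) +
            padicValNat 2 W'.tamagawaProduct ≤
          padicValRat 2 q + 2 * (padicValNat 2 W'.torsionOrder : ℤ) := by
  -- Kato's member `W'` and the fact's data at it
  obtain ⟨W', hE', hM', hiso, hrest⟩ := hin W hcm hng hnm hj hred hL hfin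
  haveI := hE'
  haveI := hM'
  haveI : ContinuousSMul ℤ_[2] (W'.tateModule 2) := TateModule.continuousSMul_padicInt
  haveI : Module.Free ℤ_[2] (W'.tateModule 2) := W'.module_free_tateModule_holds 2
  haveI : Module.Finite ℤ_[2] (W'.tateModule 2) := W'.module_finite_tateModule_holds 2
  -- statement (A) at `(W', 2)`: `W'[2]` is reducible with `W[2]`; Lim@2 + Ferrero–Washington BY NAME
  have hred' : ¬ W'.HasIrreducibleModPGaloisRep 2 := not_hasIrreducibleModPGaloisRep_of_isIsogenous hiso hred
  have hA' := conjA_two_of_not_irreducible hLim2 hFW W' hred'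
  -- a newform of `W` (modularity) and a family of complex embeddings of the cyclotomic fields
  haveI : NeZero (W.conductorNorm ℤ) := ⟨(W.conductorNorm_pos_holds).ne'⟩
  obtain ⟨f, hf⟩ := hmod W
  obtain ⟨κ', Λ', c, d, a, A, z, x, -, -, -, -, hbody, hpack⟩ :=
    hrest hA' f hf (fun m => Classical.arbitrary _)
  -- the cyclotomic `ℤ₂`-tower with a topological generator (PROVED), the pinned `𝐇¹_Γ(T₂W')`, the lift `𝐲`
  obtain ⟨κ, hκ, γ, hγ, -⟩ := exists_isCyclotomic_isTopGenerator_isCyclotomicVariable_holds 2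
  obtain ⟨I⟩ := nonempty_iwasawaH1Data_holds W' 2 κ γ hκ hγ
  obtain ⟨y, hy⟩ :=
    (IwasawaH1Data.existsUnique_lift_of_zetaBody_two W' hκ I f (fun m => Classical.arbitrary _)
      κ' Λ' c d a A z x hbody).exists
  -- the package at `(I, 𝐲)` together with the SHARP count
  obtain ⟨K, q, hq, hcount⟩ := hpack κ γ hκ hγ I y hy
  have hfin' : Finite W'.sha := (IsIsogenous.shaFinite_iff_shaFinite hiso).mp hfin
  haveI := K.finite_H
  haveI := K.torsionFree_H
  haveI := K.finite_F
  haveI := K.torsionFree_F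
  haveI := K.finite_H2
  -- the divisibility for the hull at EVERY height-one prime: off `(2)` Thm. 12.5 (3), at `(2)` `μ = 0`
  have hdiv : ∀ 𝔮 : PrimeSpectrum (IwasawaAlgebra 2), 𝔮.asIdeal.height = 1 →
      Module.lengthAt (IwasawaAlgebra 2) K.H2 𝔮 ≤
        Module.lengthAt (IwasawaAlgebra 2) (K.F ⧸ (IwasawaAlgebra 2) ∙ K.z) 𝔮 := by
    intro 𝔮 h𝔮
    by_cases hq' : 𝔮.asIdeal = augIdealP 2
    · have hμ : (Module.lengthAt (IwasawaAlgebra 2) K.H2 𝔮).toNat = 0 := by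
        rw [← muInvariant_eq_toNat_lengthAt 2 K.H2 𝔮 hq']; exact K.mu_H2
      have hfinl : Module.lengthAt (IwasawaAlgebra 2) K.H2 𝔮 ≠ ⊤ :=
        IwasawaAlgebra.lengthAt_ne_top_of_isTorsion K.H2 K.isTorsion_H2 𝔮 (le_of_eq h𝔮)
      have h0' : Module.lengthAt (IwasawaAlgebra 2) K.H2 𝔮 = 0 := by
        rw [← ENat.coe_toNat hfinl, hμ]; rfl
      rw [h0']
      exact bot_le
    · exact K.divisibility_offP 𝔮 h𝔮 hq'
  -- the hull descent with the multiplier (PROVED module theory over `ℤ₂⟦X⟧`)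
  have hhull := valuation_add_padicValNat_coinvariants_le_of_hull_smul K.j K.j_injective
    K.finite_coker K.z K.z_ne_zero K.isTorsion_quotient K.isTorsion_H2 hdiv y K.lam
    K.lam_constantCoeff_ne_zero K.j_y K.ι K.π K.ι_injective K.π_surjective K.exact_ι_π
    K.finite_coinvariants_H2 K.index_ne_zero
  -- the sharp count; the multiplier and the `𝐇²` terms cancel
  refine ⟨W', hE', hM', hiso, hfin', q, hq, ?_⟩
  have hhull' : ((PowerSeries.constantCoeff K.lam).valuation : ℤ) +
      (padicValNat 2 (Nat.card (coinvariants 2 K.H2)) : ℤ) ≤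
      (padicValNat 2 (Nat.card (K.A ⧸ (IwasawaAlgebra 2) ∙ K.ι (Submodule.Quotient.mk y))) : ℤ) := by
    exact_mod_cast hhull
  linarith

/-! ## §2 Miller currency: a `2t`-count IS the upper half at the member -/

/-- **A count with BSD's own exponent `2t` is `MissingUpperBoundAt`** (Miller's currency, rank `0`): if
`L(W',1)/Ω(W') = q` and `ord_p #Ш(W')(p) + v_p Tam(W') ≤ ord_p q + 2·ord_p #W'(ℚ)_tors` for a curve of analytic rank
`0` with finite `Ш`, then `#Ш_an(W') = q·#tors²/Tam` (regulator `1`, GZK) is a rational `q'` with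
`ord_p #Ш(W') ≤ ord_p q'`. The proof of `O6.exists_shaAn_le_add_torsion_of_katoCurrency` with `2t` for `3t`;
conditional on GZK (`hGZK`, rank `= r_an`) and modularity (`hmod`, `L` entire). [cite: Miller2011LMS, Def. 1.1 (arXiv:1010.2431 p. 3)] -/
theorem missingUpperBoundAt_of_sharpKatoCurrency (hGZK : rank_eq_analyticRank_of_analyticRank_le_one)
    (hmod : hasEntireLFunction_rat) (W' : WeierstrassCurve ℚ) [W'.IsElliptic] (p : ℕ) [Fact p.Prime]
    (hr' : W'.analyticRank = 0) (hfin' : Finite W'.sha) {q : ℚ}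
    (hq : W'.entireLFunction 1 / (W'.realPeriodRat : ℂ) = (q : ℂ))
    (hle : (padicValNat p (Nat.card (AddCommGroup.primaryComponent W'.sha p)) : ℤ) +
        padicValNat p W'.tamagawaProduct ≤ padicValRat p q + 2 * (padicValNat p W'.torsionOrder : ℤ)) :
    MissingUpperBoundAt W' p := by
  haveI : Finite W'.sha := hfin'
  obtain ⟨hmw', -⟩ := hGZK W' (by rw [hr']; exact zero_le_one)
  have hmw0' : W'.mordellWeilRank = 0 := by rw [hmw', hr']
  have hΩ : (W'.realPeriodRat : ℂ) ≠ 0 := by exact_mod_cast W'.realPeriodRat_pos_holds.ne'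
  have hc0 : 0 < W'.tamagawaProduct := W'.tamagawaProduct_pos_holds
  have ht0 : 0 < W'.torsionOrder := W'.torsionOrder_pos_holds
  have hL' : W'.entireLFunction 1 ≠ 0 := (W'.analyticRank_eq_zero_iff_holds (hmod W')).mp hr'
  have hq0 : q ≠ 0 := by
    rintro rfl
    rw [Rat.cast_zero, div_eq_zero_iff] at hq
    exact hq.elim hL' hΩ
  have ht : (W'.torsionOrder : ℚ) ≠ 0 := by exact_mod_cast ht0.ne'
  have hcq : (W'.tamagawaProduct : ℚ) ≠ 0 := by exact_mod_cast hc0.ne'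
  refine ⟨q * (W'.torsionOrder : ℚ) ^ 2 / (W'.tamagawaProduct : ℚ), ?_, ?_⟩
  · have hLq : W'.entireLFunction 1 = (q : ℂ) * (W'.realPeriodRat : ℂ) := by
      rw [← hq, div_mul_cancel₀ _ hΩ]
    rw [shaAn_def, leadingLCoeff_eq_of_analyticRank_eq_zero W' hr', W'.regulator_eq_one_of_rank_zero hmw0', hLq]
    push_cast
    field_simp
  · have hsha : padicValNat p (Nat.card (AddCommGroup.primaryComponent W'.sha p)) =
        padicValNat p W'.shaOrder := by
      unfold WeierstrassCurve.shaOrder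
      exact padicValNat_card_addPrimaryComponent p
    have hv : padicValRat p (q * (W'.torsionOrder : ℚ) ^ 2 / (W'.tamagawaProduct : ℚ)) =
        padicValRat p q + 2 * (padicValNat p W'.torsionOrder : ℤ) -
          (padicValNat p W'.tamagawaProduct : ℤ) := by
      rw [padicValRat.div (mul_ne_zero hq0 (pow_ne_zero 2 ht)) hcq, padicValRat.mul hq0 (pow_ne_zero 2 ht),
        pow_two, padicValRat.mul ht ht, padicValRat.of_nat, padicValRat.of_nat]
      ring
    rw [hv, ← hsha]
    linarith

/-! ## §3 The upper half on the WHOLE reducible block (Cassels transport from the member) -/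

/-- **hU3 = `MissingUpperBoundAt W 2` on the whole `E[2]`-REDUCIBLE additive potentially-good rank-`0` non-CM block**
— granted `hmod`/`hrat` (modularity, both spellings), the sharp member fact (`hin`), Lim@2 (`hLim2`), Ferrero–Washington
(`hFW`), Cassels' isogeny invariance (`hCassels`) and GZK (`hGZK`) BY NAME; NO torsion side condition and NO parity
hypothesis (contrast `missingUpperBoundAt_two_of_katoMember_two`). Proof: at Kato's member `W' ∼ W` (§1; `L(W,1) ≠ 0`
by modularity, `Ш(W)` finite by GZK) the sharp count is `MissingUpperBoundAt W' 2` (§2); Cassels transports the upper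
half along `W' ∼ W` (`TwistComparison.missingUpperBoundAt_of_isIsogenous`: `#Ш_an/#Ш` is constant on the class).
Conditional on the named facts; nothing else assumed.
[cite: Kato2004Asterisque, Prop. 14.16 (2) and its proof (pp. 244–245)] [cite: Cassels1965ArithmeticVIII]
[cite: MilneADT2006, Thm. I.7.3] [cite: Miller2011LMS, Def. 1.1] -/
theorem missingUpperBoundAt_two_of_katoMemberSharp_two (hmod : exists_isNewformOf)
    (hin : Kato2004.exists_memberHullInputs_two_sharp)
    (hLim2 : Lim2017.thm35_at_two_fineSelmerDual_moduleFinite_of_classicalMuVanishes_of_le_divisionField_four)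
    (hFW : ferreroWashington1979_classicalMuVanishes)
    (hCassels : bsdRHS_eq_of_isIsogenous)
    (hGZK : rank_eq_analyticRank_of_analyticRank_le_one) (hrat : hasEntireLFunction_rat)
    (W : WeierstrassCurve ℚ) [W.IsElliptic] [W.IsGloballyMinimal] (hcm : ¬ W.HasCM)
    (hng : ¬ W.HasGoodReductionAtPrime 2) (hnm : ¬ W.HasMultiplicativeReductionAtPrime 2)
    (hj : 0 ≤ padicValRat 2 W.j) (hred : ¬ W.HasIrreducibleModPGaloisRep 2)
    (hr : W.analyticRank = 0) :
    MissingUpperBoundAt W 2 := by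
  -- `L(W,1) ≠ 0` (modularity) and `Ш(W)` finite (GZK)
  have hL : W.entireLFunction 1 ≠ 0 := (W.analyticRank_eq_zero_iff_holds (hrat W)).mp hr
  have hr1 : W.analyticRank ≤ 1 := by rw [hr]; exact zero_le_one
  have hfinW : W.ShaFinite := (hGZK W hr1).2
  -- Kato's member `W'` with the sharp count
  obtain ⟨W', hE', hM', hiso, hfin', q, hq, hle⟩ :=
    katoMemberShaBound_two_sharp hmod hin hLim2 hFW W hcm hng hnm hj hred hL hfinW
  haveI := hE'
  haveI := hM'
  have hr' : W'.analyticRank = 0 := by rw [← analyticRank_eq_of_isIsogenous' hiso, hr]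
  have hr1' : W'.analyticRank ≤ 1 := by rw [hr']; exact zero_le_one
  -- the upper half at the member, then Cassels transport `W' ∼ W`
  have hW' : MissingUpperBoundAt W' 2 :=
    missingUpperBoundAt_of_sharpKatoCurrency hGZK hrat W' 2 hr' hfin' hq hle
  exact TwistComparison.missingUpperBoundAt_of_isIsogenous _ W 2 hCassels hGZK hrat hiso.symm_of_charZero hr1' hW'

/-! ## §4 The block form keyed by `Addv W 2` -/

/-- **The UPPER half at `2` on the `E[2]`-reducible additive potentially-good rank-`0` non-CM block, in the route's
vocabulary** (`Addv W 2 = ¬good ∧ ¬multiplicative`): `¬CM → r_an = 0 → Addv W 2 → 0 ≤ ord₂ j → ¬irreducible →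
MissingUpperBoundAt W 2`, from the sharp member fact + PRINT BY NAME. Conditional; nothing asserted.
[cite: Kato2004Asterisque, Prop. 14.16 (2) and its proof (pp. 244–245)] [cite: Cassels1965ArithmeticVIII] -/
theorem additivePotGoodReducibleUpperAtTwo_of_sharpMember (hmod : exists_isNewformOf)
    (hrat : hasEntireLFunction_rat) (hin : Kato2004.exists_memberHullInputs_two_sharp)
    (hLim2 : Lim2017.thm35_at_two_fineSelmerDual_moduleFinite_of_classicalMuVanishes_of_le_divisionField_four)
    (hFW : ferreroWashington1979_classicalMuVanishes) (hCassels : bsdRHS_eq_of_isIsogenous)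
    (hGZK : rank_eq_analyticRank_of_analyticRank_le_one) :
    ∀ (W : WeierstrassCurve ℚ) [W.IsElliptic] [W.IsGloballyMinimal], ¬ W.HasCM → W.analyticRank = 0 →
      Addv W 2 → 0 ≤ padicValRat 2 W.j → ¬ W.HasIrreducibleModPGaloisRep 2 → MissingUpperBoundAt W 2 := by
  intro W _ _ hcm hr hadd hj hred
  exact missingUpperBoundAt_two_of_katoMemberSharp_two hmod hin hLim2 hFW hCassels hGZK hrat W hcm hadd.1 hadd.2
    hj hred hr

/-! ## §5 The route decl C2″ verbatim, conditional on the named facts -/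

/-- **C2″ `AdditivePotGoodReducibleRestAtTwo` (item stmt-BirchSwinnertonDyer-22616) from PRINT BY NAME plus the sharp
member reading** — the route decl VERBATIM as conclusion; its «rest» hypothesis (off the member sub-block) is not used,
since §4 gives the upper half on the whole reducible block. CONDITIONAL on: modularity (`hmod`, `hrat`), the sharp
member fact `Kato2004.exists_memberHullInputs_two_sharp` (`hin`; Kato §§12–14 at `2` read at the member, audited as
hMH2@2, plus the bookkeeping step R12♯ — D-audit wanted), Lim 2017 Thm. 3.5 at `2` (`hLim2`), Ferrero–Washington
(`hFW`), Cassels' isogeny invariance (`hCassels`), Gross–Zagier–Kolyvagin (`hGZK`). The item does NOT close (named-fact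
hypotheses); this records that C2″ carries no research content beyond those names.
[cite: Kato2004Asterisque, Thm. 12.4–12.6 (pp. 221–222), Thm. 14.5 (p. 236), Prop. 14.16 (2) and its proof (pp. 244–245)]
[cite: Lim2017FineSelmer, §3 Thm. 3.5] [cite: FerreroWashington1979, Theorem] [cite: Cassels1965ArithmeticVIII]
[cite: MilneADT2006, Thm. I.7.3] -/
theorem additivePotGoodReducibleRestAtTwo_of_sharpMember (hmod : exists_isNewformOf)
    (hrat : hasEntireLFunction_rat) (hin : Kato2004.exists_memberHullInputs_two_sharp)
    (hLim2 : Lim2017.thm35_at_two_fineSelmerDual_moduleFinite_of_classicalMuVanishes_of_le_divisionField_four)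
    (hFW : ferreroWashington1979_classicalMuVanishes) (hCassels : bsdRHS_eq_of_isIsogenous)
    (hGZK : rank_eq_analyticRank_of_analyticRank_le_one) :
    Summit.BirchSwinnertonDyer.BirchSwinnertonDyer.Theses.ByReductionTypeAtTwo.AdditivePotGoodReducibleRestAtTwo := by
  intro W _ _ hcm hr hadd hj hred _
  exact additivePotGoodReducibleUpperAtTwo_of_sharpMember hmod hrat hin hLim2 hFW hCassels hGZK W hcm hr hadd hj hred

/-! ## §6 (APPEND, pen RC-342 condition (3)) The chain below the count takes the SHARP MEMBER BOUND as a displayed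
hypothesis, so that the sharp reading enters through EXACTLY ONE lemma (`katoMemberShaBound_two_sharp`, §1) and an R-B77
downgrade of `Kato2004.exists_memberHullInputs_two_sharp` to a Theorems-side `@[conjecture]` reading is a one-decl re-point -/

/-- **The upper half on the whole `E[2]`-reducible additive potentially-good rank-`0` non-CM block FROM THE SHARP MEMBER BOUND
DISPLAYED** (`hmem`: for every such `W` with `L(W,1) ≠ 0` and `Ш(W)` finite, a globally minimal `W' ∼ W` with `Ш(W')` finite
and `ord₂ #Ш(W')[2^∞] + v₂ Tam(W') ≤ ord₂(L(W',1)/Ω(W')) + 2·ord₂ #W'(ℚ)_tors` — the conclusion of §1 verbatim, whatever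
supplies it) plus Cassels (`hCassels`), GZK (`hGZK`) and modularity (`hrat`) BY NAME: `MissingUpperBoundAt W 2`. Proof = §3
with §1 replaced by `hmem` (Miller currency §2 + `TwistComparison.missingUpperBoundAt_of_isIsogenous`). Conditional; the
sharp reading is NOT a hypothesis here. [cite: Cassels1965ArithmeticVIII] [cite: MilneADT2006, Thm. I.7.3] [cite: Miller2011LMS, Def. 1.1] -/
theorem missingUpperBoundAt_two_of_sharpMemberBound
    (hmem : ∀ (W : WeierstrassCurve ℚ) [W.IsElliptic] [W.IsGloballyMinimal], ¬ W.HasCM →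
      ¬ W.HasGoodReductionAtPrime 2 → ¬ W.HasMultiplicativeReductionAtPrime 2 → 0 ≤ padicValRat 2 W.j →
      ¬ W.HasIrreducibleModPGaloisRep 2 → W.entireLFunction 1 ≠ 0 → Finite W.sha →
      ∃ (W' : WeierstrassCurve ℚ) (_ : W'.IsElliptic) (_ : W'.IsGloballyMinimal),
        IsIsogenous W W' ∧ Finite W'.sha ∧
        ∃ q : ℚ, W'.entireLFunction 1 / (W'.realPeriodRat : ℂ) = (q : ℂ) ∧
          (padicValNat 2 (Nat.card (AddCommGroup.primaryComponent W'.sha 2)) : ℤ) +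
              padicValNat 2 W'.tamagawaProduct ≤
            padicValRat 2 q + 2 * (padicValNat 2 W'.torsionOrder : ℤ))
    (hCassels : bsdRHS_eq_of_isIsogenous)
    (hGZK : rank_eq_analyticRank_of_analyticRank_le_one) (hrat : hasEntireLFunction_rat)
    (W : WeierstrassCurve ℚ) [W.IsElliptic] [W.IsGloballyMinimal] (hcm : ¬ W.HasCM)
    (hng : ¬ W.HasGoodReductionAtPrime 2) (hnm : ¬ W.HasMultiplicativeReductionAtPrime 2)
    (hj : 0 ≤ padicValRat 2 W.j) (hred : ¬ W.HasIrreducibleModPGaloisRep 2)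
    (hr : W.analyticRank = 0) :
    MissingUpperBoundAt W 2 := by
  have hL : W.entireLFunction 1 ≠ 0 := (W.analyticRank_eq_zero_iff_holds (hrat W)).mp hr
  have hr1 : W.analyticRank ≤ 1 := by rw [hr]; exact zero_le_one
  have hfinW : W.ShaFinite := (hGZK W hr1).2
  obtain ⟨W', hE', hM', hiso, hfin', q, hq, hle⟩ := hmem W hcm hng hnm hj hred hL hfinW
  haveI := hE'
  haveI := hM'
  have hr' : W'.analyticRank = 0 := by rw [← analyticRank_eq_of_isIsogenous' hiso, hr]
  have hr1' : W'.analyticRank ≤ 1 := by rw [hr']; exact zero_le_one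
  have hW' : MissingUpperBoundAt W' 2 :=
    missingUpperBoundAt_of_sharpKatoCurrency hGZK hrat W' 2 hr' hfin' hq hle
  exact TwistComparison.missingUpperBoundAt_of_isIsogenous _ W 2 hCassels hGZK hrat hiso.symm_of_charZero hr1' hW'

/-- **C2″ `AdditivePotGoodReducibleRestAtTwo` (item 22616) FROM THE SHARP MEMBER BOUND DISPLAYED** — the route decl VERBATIM,
conditional on `hmem` (the sharp member bound at `2` on the reducible potentially-good block, §6's hypothesis) + Cassels + GZK
+ modularity BY NAME. With §1 (`katoMemberShaBound_two_sharp hmod hin hLim2 hFW`) for `hmem` this is §5; after an R-B77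
downgrade only §1's hypothesis type changes. [cite: Cassels1965ArithmeticVIII] [cite: MilneADT2006, Thm. I.7.3]
[cite: Miller2011LMS, Def. 1.1] -/
theorem additivePotGoodReducibleRestAtTwo_of_sharpMemberBound
    (hmem : ∀ (W : WeierstrassCurve ℚ) [W.IsElliptic] [W.IsGloballyMinimal], ¬ W.HasCM →
      ¬ W.HasGoodReductionAtPrime 2 → ¬ W.HasMultiplicativeReductionAtPrime 2 → 0 ≤ padicValRat 2 W.j →
      ¬ W.HasIrreducibleModPGaloisRep 2 → W.entireLFunction 1 ≠ 0 → Finite W.sha →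
      ∃ (W' : WeierstrassCurve ℚ) (_ : W'.IsElliptic) (_ : W'.IsGloballyMinimal),
        IsIsogenous W W' ∧ Finite W'.sha ∧
        ∃ q : ℚ, W'.entireLFunction 1 / (W'.realPeriodRat : ℂ) = (q : ℂ) ∧
          (padicValNat 2 (Nat.card (AddCommGroup.primaryComponent W'.sha 2)) : ℤ) +
              padicValNat 2 W'.tamagawaProduct ≤
            padicValRat 2 q + 2 * (padicValNat 2 W'.torsionOrder : ℤ))
    (hCassels : bsdRHS_eq_of_isIsogenous)
    (hGZK : rank_eq_analyticRank_of_analyticRank_le_one) (hrat : hasEntireLFunction_rat) :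
    Summit.BirchSwinnertonDyer.BirchSwinnertonDyer.Theses.ByReductionTypeAtTwo.AdditivePotGoodReducibleRestAtTwo := by
  intro W _ _ hcm hr hadd hj hred _
  exact missingUpperBoundAt_two_of_sharpMemberBound hmem hCassels hGZK hrat W hcm hadd.1 hadd.2 hj hred hr

/-- **§5 re-derived through §6** (the factorisation check): the sharp reading enters only via §1. Bookkeeping.
[cite: Kato2004Asterisque, Prop. 14.16 (2) and its proof (pp. 244–245)] [cite: Cassels1965ArithmeticVIII] -/
theorem additivePotGoodReducibleRestAtTwo_of_sharpMember' (hmod : exists_isNewformOf)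
    (hrat : hasEntireLFunction_rat) (hin : Kato2004.exists_memberHullInputs_two_sharp)
    (hLim2 : Lim2017.thm35_at_two_fineSelmerDual_moduleFinite_of_classicalMuVanishes_of_le_divisionField_four)
    (hFW : ferreroWashington1979_classicalMuVanishes) (hCassels : bsdRHS_eq_of_isIsogenous)
    (hGZK : rank_eq_analyticRank_of_analyticRank_le_one) :
    Summit.BirchSwinnertonDyer.BirchSwinnertonDyer.Theses.ByReductionTypeAtTwo.AdditivePotGoodReducibleRestAtTwo :=
  additivePotGoodReducibleRestAtTwo_of_sharpMemberBound
    (fun W _ _ hcm hng hnm hj hred hL hfin => katoMemberShaBound_two_sharp hmod hin hLim2 hFW W hcm hng hnm hj hred hL hfin)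
    hCassels hGZK hrat

end Summit.BirchSwinnertonDyer.BirchSwinnertonDyer.Theorems.AddKatoTwo

end
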